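import Mathlib
import Summits.Ventures.PercRepro2.Tail2DBlockCalc
import Summits.Ventures.PercRepro2.Tail2DHarrisSP

/-!
# Flow-one networks: blocks, Harris dominations, and the tails of their parallel compositions
(seat mine-b, cell pub-perc-repro2; conjectures/MINE-B.md §42)

A FLOW-ONE network has `r + b ≤ 1` on every configuration (`FlowOne`), so its labels are `(1,0)` (a red crossing,
the block `rSet`), `(0,1)` (a blue crossing, `bSet`) and `(0,0)`.  The red label is antitone and the blue label
monotone on every SP term (`rLab_antitone`, `bLab_monotone`), so `rSet` and the row `{b = 0}` are lower sets and
`bSet` and the column `{r = 0}` (`colSet`) are upper sets: by Harris (`Tail2DHarrisSP.lean`) `R ≼ B`, `R ≼ all`,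
`all ≼ B`, `all ≼ col`, `R ≼ col`, `row ≼ B`.  The counts: `#B = #R` (the colour swap), `#col = #row = #all − #R`.
On the parallel composition of two flow-one networks the tails are explicit product blocks (`tailSet_par_*`), with
counts `#E(2,0) = #R #R'`, `#E(1,1) = 2 #R #R'`, `#E(1,0) = #R #all' + (#all − #R) #R'`, and the tails beyond the
total flow `2` are empty (`tailCount_par_big`).  `Tail2DFlowOnePar.lean` turns these into the certificates of (SD).
-/

namespace Summit.Ventures.PercRepro2.Tail2D

open V2Closure Finset

section Labels

/-- the red label is antitone in the configuration order -/
theorem rLab_antitone : ∀ s : V2Closure.SP, Antitone s.rLab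
  | .free => by
      intro x y hxy
      cases x <;> cases y <;> first | exact absurd (Bool.le_iff_imp.1 hxy rfl) Bool.false_ne_true | simp [SP.rLab]
  | .pin => fun _ _ _ => le_rfl
  | .absent => fun _ _ _ => le_rfl
  | .ser s t => by
      intro x y hxy
      have h1 := rLab_antitone s hxy.1; have h2 := rLab_antitone t hxy.2
      show min (s.rLab y.1) (t.rLab y.2) ≤ min (s.rLab x.1) (t.rLab x.2)
      exact min_le_min h1 h2
  | .par s t => by
      intro x y hxy
      have h1 := rLab_antitone s hxy.1; have h2 := rLab_antitone t hxy.2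
      show s.rLab y.1 + t.rLab y.2 ≤ s.rLab x.1 + t.rLab x.2
      omega

/-- the blue label is monotone in the configuration order -/
theorem bLab_monotone : ∀ s : V2Closure.SP, Monotone s.bLab
  | .free => by
      intro x y hxy
      cases x <;> cases y <;> first | exact absurd (Bool.le_iff_imp.1 hxy rfl) Bool.false_ne_true | simp [SP.bLab]
  | .pin => fun _ _ _ => le_rfl
  | .absent => fun _ _ _ => le_rfl
  | .ser s t => by
      intro x y hxy
      have h1 := bLab_monotone s hxy.1; have h2 := bLab_monotone t hxy.2
      show min (s.bLab x.1) (t.bLab x.2) ≤ min (s.bLab y.1) (t.bLab y.2)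
      exact min_le_min h1 h2
  | .par s t => by
      intro x y hxy
      have h1 := bLab_monotone s hxy.1; have h2 := bLab_monotone t hxy.2
      show s.bLab x.1 + t.bLab x.2 ≤ s.bLab y.1 + t.bLab y.2
      omega

end Labels

section FlowOne

variable (s : V2Closure.SP)

/-- a flow-one network: `r + b ≤ 1` on every configuration -/
def FlowOne : Prop := ∀ x : s.Conf, s.rLab x + s.bLab x ≤ 1

/-- the red crossings `R = {r = 1} = E(1,0)` -/
def rSet : Finset s.Conf := tailSet s 1 0
/-- the blue crossings `B = {b = 1} = E(0,1)` -/
def bSet : Finset s.Conf := tailSet s 0 1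
/-- the column `{r = 0}` -/
def colSet : Finset s.Conf := Finset.univ.filter (fun x : s.Conf => s.rLab x = 0)
/-- the cell `{r = 0, b = 0}` (no crossing) -/
def cellSet : Finset s.Conf := Finset.univ.filter (fun x : s.Conf => s.rLab x = 0 ∧ s.bLab x = 0)

/-- membership in the red crossings -/
theorem mem_rSet (x : s.Conf) : x ∈ rSet s ↔ 1 ≤ s.rLab x := by
  simp [rSet, tailSet]
/-- membership in the blue crossings -/
theorem mem_bSet (x : s.Conf) : x ∈ bSet s ↔ 1 ≤ s.bLab x := by
  simp [bSet, tailSet]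
/-- membership in the column `{r = 0}` -/
theorem mem_colSet (x : s.Conf) : x ∈ colSet s ↔ s.rLab x = 0 := by
  simp [colSet]
/-- membership in the cell `{r = 0, b = 0}` -/
theorem mem_cellSet (x : s.Conf) : x ∈ cellSet s ↔ s.rLab x = 0 ∧ s.bLab x = 0 := by
  simp [cellSet]
/-- membership in the row `{b = 0}` -/
theorem mem_rowSet0 (x : s.Conf) : x ∈ rowSet s 0 ↔ s.bLab x = 0 := by
  simp [rowSet]

/-- the red crossings form a lower set -/
theorem rSet_lower : ∀ x y : s.Conf, x ≤ y → y ∈ rSet s → x ∈ rSet s := by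
  intro x y hxy hy
  rw [mem_rSet] at hy ⊢
  exact le_trans hy (rLab_antitone s hxy)
/-- the blue crossings form an upper set -/
theorem bSet_upper : ∀ x y : s.Conf, x ≤ y → x ∈ bSet s → y ∈ bSet s := by
  intro x y hxy hx
  rw [mem_bSet] at hx ⊢
  exact le_trans hx (bLab_monotone s hxy)
/-- the column `{r = 0}` is an upper set -/
theorem colSet_upper : ∀ x y : s.Conf, x ≤ y → x ∈ colSet s → y ∈ colSet s := by
  intro x y hxy hx
  rw [mem_colSet] at hx ⊢
  have := rLab_antitone s hxy
  omega
/-- the row `{b = 0}` is a lower set -/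
theorem rowSet0_lower : ∀ x y : s.Conf, x ≤ y → y ∈ rowSet s 0 → x ∈ rowSet s 0 := by
  intro x y hxy hy
  rw [mem_rowSet0] at hy ⊢
  have := bLab_monotone s hxy
  omega

/-- the Harris dominations of the flow-one blocks -/
theorem dom_r_b : BlockDom s (rSet s) (bSet s) :=
  blockDom_lower_upper s _ _ (rSet_lower s) (bSet_upper s)
/-- `R ≼ all` (Harris) -/
theorem dom_r_univ : BlockDom s (rSet s) Finset.univ := blockDom_lower_univ s _ (rSet_lower s)
/-- `all ≼ B` (Harris) -/
theorem dom_univ_b : BlockDom s Finset.univ (bSet s) := blockDom_univ_upper s _ (bSet_upper s)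
/-- `all ≼ col` (Harris) -/
theorem dom_univ_col : BlockDom s Finset.univ (colSet s) := blockDom_univ_upper s _ (colSet_upper s)
/-- `R ≼ col` (Harris, through `all`) -/
theorem dom_r_col : BlockDom s (rSet s) (colSet s) :=
  blockDom_lower_upper s _ _ (rSet_lower s) (colSet_upper s)
/-- `row ≼ B` (Harris, through `all`) -/
theorem dom_row_b : BlockDom s (rowSet s 0) (bSet s) :=
  blockDom_lower_upper s _ _ (rowSet0_lower s) (bSet_upper s)

end FlowOne

section Counts

variable (s : V2Closure.SP)

/-- the three label classes of a flow-one network -/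
theorem flowOne_cases (hs : FlowOne s) (x : s.Conf) :
    (s.rLab x = 1 ∧ s.bLab x = 0) ∨ (s.rLab x = 0 ∧ s.bLab x = 1) ∨ (s.rLab x = 0 ∧ s.bLab x = 0) := by
  have := hs x; omega

/-- the blue crossings are as many as the red ones (the colour swap) -/
theorem card_bSet_eq : (bSet s).card = (rSet s).card := by
  unfold bSet rSet
  rw [← tailCount_eq_card, ← tailCount_eq_card]
  exact tailCount_symm s 0 1

/-- the column `{r = 0}` is the complement of the red crossings (flow one) -/
theorem colSet_eq_compl (hs : FlowOne s) : colSet s = (rSet s)ᶜ := by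
  ext x
  rw [Finset.mem_compl, mem_colSet, mem_rSet]
  have := hs x; omega

/-- `#{r = 0} = #all − #R` -/
theorem card_colSet (hs : FlowOne s) : (colSet s).card = Fintype.card s.Conf - (rSet s).card := by
  rw [colSet_eq_compl s hs, Finset.card_compl]

/-- the row `{b = 0}` is the complement of the blue crossings -/
theorem rowSet0_eq_compl : rowSet s 0 = (bSet s)ᶜ := by
  ext x
  rw [Finset.mem_compl, mem_rowSet0, mem_bSet]
  omega

/-- `#{b = 0} = #all − #R` -/
theorem card_rowSet0 : (rowSet s 0).card = Fintype.card s.Conf - (rSet s).card := by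
  rw [rowSet0_eq_compl, Finset.card_compl, card_bSet_eq]

/-- the red crossings are at most all configurations -/
theorem card_rSet_le : (rSet s).card ≤ Fintype.card s.Conf := by
  rw [← Finset.card_univ]; exact Finset.card_le_univ _

end Counts

section Par

variable (s t : V2Closure.SP)

/-- membership in a tail of a parallel composition, by the labels of the two coordinates -/
theorem mem_tailSet_par (a c : ℕ) (x : s.Conf) (y : t.Conf) :
    ((x, y) : s.Conf × t.Conf) ∈ tailSet (V2Closure.SP.par s t) a c ↔
      a ≤ s.rLab x + t.rLab y ∧ c ≤ s.bLab x + t.bLab y := by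
  show ((x, y) : s.Conf × t.Conf) ∈ (Finset.univ.filter (fun p : s.Conf × t.Conf =>
      a ≤ parR s.rLab t.rLab p ∧ c ≤ parB s.bLab t.bLab p) : Finset (s.Conf × t.Conf)) ↔ _
  simp only [Finset.mem_filter, Finset.mem_univ, true_and, parR, parB]

/-- membership in a tail of a parallel composition, for a configuration of the composition -/
theorem mem_tailSet_par' (a c : ℕ) (p : (V2Closure.SP.par s t).Conf) :
    p ∈ tailSet (V2Closure.SP.par s t) a c ↔ a ≤ s.rLab p.1 + t.rLab p.2 ∧ c ≤ s.bLab p.1 + t.bLab p.2 :=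
  mem_tailSet_par s t a c p.1 p.2

/-- the uniform density of a product block on a parallel composition, coordinatewise -/
theorem unifDens_par_prod (A : Finset s.Conf) (B : Finset t.Conf) (x : s.Conf) (y : t.Conf) :
    unifDens (V2Closure.SP.par s t) (A ×ˢ B) ((x, y) : s.Conf × t.Conf)
      = if x ∈ A ∧ y ∈ B then ((A.card * B.card : ℕ) : ℚ)⁻¹ else 0 := by
  unfold unifDens
  show (if ((x, y) : s.Conf × t.Conf) ∈ (A ×ˢ B : Finset (s.Conf × t.Conf))
      then (((A ×ˢ B : Finset (s.Conf × t.Conf)).card : ℚ))⁻¹ else 0) = _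
  simp only [Finset.mem_product, Finset.card_product]

/-- the uniform density of a tail of a parallel composition, coordinatewise -/
theorem unifDens_par_tail (a c : ℕ) (x : s.Conf) (y : t.Conf) :
    unifDens (V2Closure.SP.par s t) (tailSet (V2Closure.SP.par s t) a c) ((x, y) : s.Conf × t.Conf)
      = if a ≤ s.rLab x + t.rLab y ∧ c ≤ s.bLab x + t.bLab y
        then ((tailCount (V2Closure.SP.par s t) a c : ℕ) : ℚ)⁻¹ else 0 := by
  unfold unifDens
  rw [tailCount_eq_card]
  show (if ((x, y) : s.Conf × t.Conf) ∈ (Finset.univ.filter (fun p : s.Conf × t.Conf =>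
      a ≤ parR s.rLab t.rLab p ∧ c ≤ parB s.bLab t.bLab p) : Finset (s.Conf × t.Conf))
      then _ else 0) = _
  simp only [Finset.mem_filter, Finset.mem_univ, true_and, parR, parB]

/-- the tail counts of a parallel composition are colour-symmetric (the colour swap) -/
theorem tailCount_par_symm (a c : ℕ) :
    tailCount (V2Closure.SP.par s t) a c = tailCount (V2Closure.SP.par s t) c a := tailCount_symm _ a c

end Par

section FlowOnePar


variable (s t : V2Closure.SP)

/-- the tail `E(1,0)` of a parallel composition is non-empty when the first factor has a red crossing -/
theorem tailCount_par_10_pos (ha : 0 < (rSet s).card) : 0 < tailCount (V2Closure.SP.par s t) 1 0 := by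
  obtain ⟨x, hx⟩ := Finset.card_pos.1 ha
  rw [tailCount_eq_card]
  apply Finset.card_pos.2
  refine ⟨((x, redConf t) : s.Conf × t.Conf), ?_⟩
  rw [mem_rSet] at hx
  exact (mem_tailSet_par s t 1 0 x (redConf t)).2 ⟨by omega, by omega⟩

/-- the column `{r = 0}` is non-empty when there is a red crossing (flow one: then there is a blue one) -/
theorem colSet_nonempty (hs : FlowOne s) (ha : 0 < (rSet s).card) : (colSet s).Nonempty := by
  obtain ⟨x, hx⟩ := Finset.card_pos.1 (show 0 < (bSet s).card by rw [card_bSet_eq]; exact ha)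
  refine ⟨x, ?_⟩
  rw [mem_colSet]; rw [mem_bSet] at hx; have := hs x; omega

/-- `#R < #all` when there is a red crossing (the blue crossings are outside `R`) -/
theorem card_rSet_lt (hs : FlowOne s) (ha : 0 < (rSet s).card) : (rSet s).card < Fintype.card s.Conf := by
  have h1 : (rSet s).card + (colSet s).card = Fintype.card s.Conf := by
    rw [card_colSet s hs]; have := card_rSet_le s; omega
  have h2 := Finset.card_pos.2 (colSet_nonempty s hs ha)
  omega

/-- the common preamble of the certificates: the counts and the non-emptiness facts -/
theorem counts (hs : FlowOne s) (ha : 0 < (rSet s).card) :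
    (bSet s).card = (rSet s).card ∧ (colSet s).card = Fintype.card s.Conf - (rSet s).card ∧
    (rowSet s 0).card = Fintype.card s.Conf - (rSet s).card ∧ (rSet s).card < Fintype.card s.Conf ∧
    (rSet s).Nonempty ∧ (bSet s).Nonempty ∧ (colSet s).Nonempty ∧ (rowSet s 0).Nonempty :=
  ⟨card_bSet_eq s, card_colSet s hs, card_rowSet0 s, card_rSet_lt s hs ha, Finset.card_pos.1 ha,
   Finset.card_pos.1 (by rw [card_bSet_eq]; exact ha), colSet_nonempty s hs ha,
   Finset.card_pos.1 (by rw [card_rowSet0]; have := card_rSet_lt s hs ha; omega)⟩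

/-- the tail sets of the parallel composition of two flow-one networks, as product blocks -/
theorem tailSet_par_20 (hs : FlowOne s) (ht : FlowOne t) :
    tailSet (V2Closure.SP.par s t) 2 0 = (rSet s ×ˢ rSet t : Finset (s.Conf × t.Conf)) := by
  apply Finset.ext; intro p
  rw [mem_tailSet_par']
  refine Iff.trans ?_ Finset.mem_product.symm
  rw [mem_rSet, mem_rSet]
  have := hs p.1; have := ht p.2; omega
/-- `E(0,2) = B × B'` -/
theorem tailSet_par_02 (hs : FlowOne s) (ht : FlowOne t) :
    tailSet (V2Closure.SP.par s t) 0 2 = (bSet s ×ˢ bSet t : Finset (s.Conf × t.Conf)) := by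
  apply Finset.ext; intro p
  rw [mem_tailSet_par']
  refine Iff.trans ?_ Finset.mem_product.symm
  rw [mem_bSet, mem_bSet]
  have := hs p.1; have := ht p.2; omega
/-- `E(0,0)` is everything -/
theorem tailSet_par_00 : tailSet (V2Closure.SP.par s t) 0 0 = Finset.univ := by
  apply Finset.ext; intro p
  rw [mem_tailSet_par']; simp
/-- `E(1,1) = R × B' ⊔ B × R'` -/
theorem tailSet_par_11 (hs : FlowOne s) (ht : FlowOne t) :
    tailSet (V2Closure.SP.par s t) 1 1
      = ((rSet s ×ˢ bSet t : Finset (s.Conf × t.Conf)) ∪ (bSet s ×ˢ rSet t : Finset (s.Conf × t.Conf))) := by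
  apply Finset.ext; intro p
  rw [mem_tailSet_par']
  refine Iff.trans ?_ Finset.mem_union.symm
  refine Iff.trans ?_ (or_congr Finset.mem_product Finset.mem_product).symm
  rw [mem_rSet, mem_bSet, mem_bSet, mem_rSet]
  have := hs p.1; have := ht p.2; omega
/-- `E(1,0) = R × all' ⊔ col × R'` -/
theorem tailSet_par_10 (hs : FlowOne s) (ht : FlowOne t) :
    tailSet (V2Closure.SP.par s t) 1 0
      = ((rSet s ×ˢ (Finset.univ : Finset t.Conf) : Finset (s.Conf × t.Conf))
          ∪ (colSet s ×ˢ rSet t : Finset (s.Conf × t.Conf))) := by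
  apply Finset.ext; intro p
  rw [mem_tailSet_par']
  refine Iff.trans ?_ Finset.mem_union.symm
  refine Iff.trans ?_ (or_congr Finset.mem_product Finset.mem_product).symm
  rw [mem_rSet, mem_colSet, mem_rSet]
  have := hs p.1; have := ht p.2; simp only [Finset.mem_univ, and_true]; omega

/-- the counts of the tails -/
theorem tailCount_par_20 (hs : FlowOne s) (ht : FlowOne t) :
    tailCount (V2Closure.SP.par s t) 2 0 = (rSet s).card * (rSet t).card := by
  rw [tailCount_eq_card, tailSet_par_20 s t hs ht]
  show (rSet s ×ˢ rSet t : Finset (s.Conf × t.Conf)).card = _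
  exact Finset.card_product _ _
/-- `#E(0,2) = #R #R'` -/
theorem tailCount_par_02 (hs : FlowOne s) (ht : FlowOne t) :
    tailCount (V2Closure.SP.par s t) 0 2 = (rSet s).card * (rSet t).card := by
  rw [tailCount_eq_card, tailSet_par_02 s t hs ht]
  show (bSet s ×ˢ bSet t : Finset (s.Conf × t.Conf)).card = _
  rw [Finset.card_product, card_bSet_eq, card_bSet_eq]
/-- `#E(0,0) = #all #all'` -/
theorem tailCount_par_00 : tailCount (V2Closure.SP.par s t) 0 0 = Fintype.card s.Conf * Fintype.card t.Conf := by
  rw [tailCount_eq_card, tailSet_par_00]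
  show (Finset.univ : Finset (s.Conf × t.Conf)).card = _
  rw [Finset.card_univ, Fintype.card_prod]
/-- `#E(1,1) = 2 #R #R'` -/
theorem tailCount_par_11 (hs : FlowOne s) (ht : FlowOne t) :
    tailCount (V2Closure.SP.par s t) 1 1 = 2 * ((rSet s).card * (rSet t).card) := by
  rw [tailCount_eq_card, tailSet_par_11 s t hs ht]
  show ((rSet s ×ˢ bSet t : Finset (s.Conf × t.Conf)) ∪ (bSet s ×ˢ rSet t : Finset (s.Conf × t.Conf))).card = _
  rw [Finset.card_union_of_disjoint, Finset.card_product, Finset.card_product, card_bSet_eq, card_bSet_eq]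
  · ring
  · rw [Finset.disjoint_left]
    intro p h1 h2
    rw [Finset.mem_product, mem_rSet, mem_bSet] at h1 h2
    have := hs p.1; omega
/-- `#E(1,0) = #R #all' + (#all − #R) #R'` -/
theorem tailCount_par_10 (hs : FlowOne s) (ht : FlowOne t) :
    tailCount (V2Closure.SP.par s t) 1 0
      = (rSet s).card * Fintype.card t.Conf + (Fintype.card s.Conf - (rSet s).card) * (rSet t).card := by
  rw [tailCount_eq_card, tailSet_par_10 s t hs ht]
  show ((rSet s ×ˢ (Finset.univ : Finset t.Conf) : Finset (s.Conf × t.Conf))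
      ∪ (colSet s ×ˢ rSet t : Finset (s.Conf × t.Conf))).card = _
  rw [Finset.card_union_of_disjoint, Finset.card_product, Finset.card_product, Finset.card_univ, card_colSet s hs]
  rw [Finset.disjoint_left]
  intro p h1 h2
  rw [Finset.mem_product, mem_rSet] at h1; rw [Finset.mem_product, mem_colSet] at h2
  omega

/-- beyond the total flow `2` the tails are empty -/
theorem tailCount_par_big (hs : FlowOne s) (ht : FlowOne t) (a c : ℕ) (h : 3 ≤ a + c) :
    tailCount (V2Closure.SP.par s t) a c = 0 := by
  rw [tailCount_eq_card, Finset.card_eq_zero, Finset.eq_empty_iff_forall_notMem]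
  intro p hp
  rw [mem_tailSet_par'] at hp
  have := hs p.1; have := ht p.2; omega

end FlowOnePar

end Summit.Ventures.PercRepro2.Tail2D
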